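import Summits.ResolutionOfSingularities.ResolutionOfSingularities.Theorems.WildCocycleLU3
import HarnessLib

/-!
# WildASPairLU (1/4) — ARTIN–SCHREIER PAIR FRAMES: kernel toys, the kind `λ₂^{AS}`, its place in `λ″`

Node «ASPairCollapse» (decomp-res lens-1 g35), tree file 1/4.  Door (W-λ₂) `WildCocycleLU.WildLogRankTwoAbove` inside
the located residual `R35`: the COCYCLE RANK of a log-diagonal frame is an invariant of the MODEL, not of the place, and it
DROPS under monoidal transforms.  An ARTIN–SCHREIER PAIR frame — two frame coordinates `x′_{j₁}, x′_{j₂} ∈ M` that are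
`℘`-generators, `σ(1/x′_{j_i}) = 1/x′_{j_i} + 1`, i.e. `σ x′_{j_i} = x′_{j_i}(1 + x′_{j_i})⁻¹`, every other frame cocycle in
the group they generate — has rank `2` on `B = M_𝔪′` (the door's PROVED test datum, the two-pivot top `g x_i = x_i/(1+x_i)`,
is one) and rank `≤ 1` after ONE monoidal transform `t = x′_{j₂}/x′_{j₁}` (`ζ = 1/x′_{j₂} − 1/x′_{j₁}` is `σ`-fixed).

* TOYS (the `σ`-calculus in the chart `x′_{j₂} = t·x′_{j₁}`, used by files 2–3): `σ t = t(1+x₁)(1+tx₁)⁻¹`,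
  `σ t − t = x₁·t(1−t)(1+tx₁)⁻¹`, `σ(1−t) = (1−t)(1+tx₁)⁻¹`, `σ(t−1) = (t−1)(1+tx₁)⁻¹`, the `λ′`-coordinates
  `t̃ = t/(1−t)` (`σ t̃ = t̃(1+x₁)`) and `t̂ = (t−1)/t` (`σ t̂ = t̂(1+x₁)⁻¹`).
* ALGEBRA: `(1+e)^n − 1 ∈ e·B` (`n : ℤ`), products of two such, fractions `z·u^n = a/b`.
* THE KIND `WildLogASPairAbove k O` (tag UNDECIDED until file 4 decides it): `λ″ = WildLogDiagonalMixedAbove` VERBATIM with the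
  unit clause and the moved clause REPLACED by the AS-pair clause; kernel inclusion `λ₂^{AS} → λ″`.
-/

noncomputable section

open IsLocalRing IntermediateField Literature.AlgebraicGeometry.Resolution
open Summit.ResolutionOfSingularities.ResolutionOfSingularities.Theorems.WildReflectionLU
open Summit.ResolutionOfSingularities.ResolutionOfSingularities.Theorems.WildLogDiagonalLU
open Summit.ResolutionOfSingularities.ResolutionOfSingularities.Theorems.TameQuotientLU

universe u

namespace Summit.ResolutionOfSingularities.ResolutionOfSingularities.Theorems.WildASPairLU

/-! ## Kernel toys: one monoidal transform of an Artin–Schreier pair -/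
section Toy

variable {E : Type u} [Field E]

/-- (I1) In the chart `x₂ = t·x₁` of the blowing up of `(x₁, x₂)`: `σ t = σx₂/σx₁ = t·(1+x₁)·(1+x₂)⁻¹` for the
Artin–Schreier pair `σ x_i = x_i(1+x_i)⁻¹`. [folklore] -/
theorem toy_apply_ratio {x₁ t : E} (hx₁ : x₁ ≠ 0) (h₁ : 1 + x₁ ≠ 0) (h₂ : 1 + t * x₁ ≠ 0) :
    t * x₁ * (1 + t * x₁)⁻¹ / (x₁ * (1 + x₁)⁻¹) = t * (1 + x₁) * (1 + t * x₁)⁻¹ := by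
  field_simp

/-- (I4) THE AUGMENTATION of `t` is DIVISIBLE BY `x₁` with the cofactor `t(1−t)(1+tx₁)⁻¹` (a unit iff `t ≢ 0, 1`):
`σ t − t = x₁·t(1−t)(1+tx₁)⁻¹`. [folklore] -/
theorem toy_apply_ratio_sub {x₁ t : E} (h₂ : 1 + t * x₁ ≠ 0) :
    t * (1 + x₁) * (1 + t * x₁)⁻¹ - t = x₁ * (t * (1 - t) * (1 + t * x₁)⁻¹) := by
  field_simp
  ring

/-- (I5) `σ(1 − t) = (1 − t)·(1 + tx₁)⁻¹`: the unit `1 − t` has the cocycle `(1+x₂)⁻¹`. [folklore] -/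
theorem toy_one_sub_apply_ratio {x₁ t : E} (h₂ : 1 + t * x₁ ≠ 0) :
    1 - t * (1 + x₁) * (1 + t * x₁)⁻¹ = (1 - t) * (1 + t * x₁)⁻¹ := by
  field_simp
  ring

/-- (I5′) `σ(t − 1) = (t − 1)·(1 + tx₁)⁻¹`. [folklore] -/
theorem toy_apply_ratio_sub_one {x₁ t : E} (h₂ : 1 + t * x₁ ≠ 0) :
    t * (1 + x₁) * (1 + t * x₁)⁻¹ - 1 = (t - 1) * (1 + t * x₁)⁻¹ := by
  field_simp
  ring

/-- (I2) THE `λ′`-COORDINATE AT `t ≡ 0`: `t̃ = t(1−t)⁻¹` has `σ t̃ = σt·(σ(1−t))⁻¹ = t̃·(1 + x₁)` — a BINOMIAL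
cocycle with the single pivot `x₁`. [folklore] -/
theorem toy_tilde {x₁ t : E} (h₂ : 1 + t * x₁ ≠ 0) (ht : 1 - t ≠ 0) :
    t * (1 + x₁) * (1 + t * x₁)⁻¹ * ((1 - t) * (1 + t * x₁)⁻¹)⁻¹ = t * (1 - t)⁻¹ * (1 + x₁) := by
  field_simp

/-- (I3) THE `λ′`-COORDINATE AT `t ≡ 1`: `t̂ = (t−1)t⁻¹` has `σ t̂ = σ(t−1)·(σt)⁻¹ = t̂·(1 + x₁)⁻¹`. [folklore] -/
theorem toy_hat {x₁ t : E} (h₁ : 1 + x₁ ≠ 0) (h₂ : 1 + t * x₁ ≠ 0) (ht : t ≠ 0) :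
    (t - 1) * (1 + t * x₁)⁻¹ * (t * (1 + x₁) * (1 + t * x₁)⁻¹)⁻¹ = (t - 1) * t⁻¹ * (1 + x₁)⁻¹ := by
  field_simp

/-- (I6) RESCALING at `t` a unit: `σ t/t = (1+x₁)(1+tx₁)⁻¹`, so `x_j·t^{N₂ j}` trades the pivot `x₂` for `x₁`:
`u·(σt/t)^{b} = (1+x₁)^{a+b}` for `u = (1+x₁)^a (1+tx₁)^b`. [folklore] -/
theorem toy_rescale_unit {x₁ t : E} (h₁ : 1 + x₁ ≠ 0) (h₂ : 1 + t * x₁ ≠ 0) (ht : t ≠ 0) (a b : ℤ) :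
    (1 + x₁) ^ a * (1 + t * x₁) ^ b * (t * (1 + x₁) * (1 + t * x₁)⁻¹ * t⁻¹) ^ b = (1 + x₁) ^ (a + b) := by
  have e : t * (1 + x₁) * (1 + t * x₁)⁻¹ * t⁻¹ = (1 + x₁) * (1 + t * x₁)⁻¹ := by field_simp
  rw [e, mul_zpow, inv_zpow, zpow_add₀ h₁, mul_mul_mul_comm, mul_inv_cancel₀ (zpow_ne_zero b h₂), mul_one]

/-- (I6′) RESCALING at `t ≡ 0`: `x_j·(1−t)^{b}` kills the second pivot: `u·(σ(1−t)/(1−t))^{b} = (1+x₁)^{a}`.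
[folklore] -/
theorem toy_rescale_one_sub {x₁ t : E} (h₂ : 1 + t * x₁ ≠ 0) (ht : 1 - t ≠ 0) (a b : ℤ) :
    (1 + x₁) ^ a * (1 + t * x₁) ^ b * ((1 - t) * (1 + t * x₁)⁻¹ * (1 - t)⁻¹) ^ b = (1 + x₁) ^ a := by
  have e : (1 - t) * (1 + t * x₁)⁻¹ * (1 - t)⁻¹ = (1 + t * x₁)⁻¹ := by field_simp
  rw [e, inv_zpow, mul_assoc, mul_inv_cancel₀ (zpow_ne_zero b h₂), mul_one]

/-- THE HIDDEN INVARIANT: `ζ = 1/x₂ − 1/x₁` is fixed, `1/σx_i = 1/x_i + 1`. [folklore] -/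
theorem toy_invariant {x₁ x₂ : E} (hx₁ : x₁ ≠ 0) (hx₂ : x₂ ≠ 0) :
    (x₂ * (1 + x₂)⁻¹)⁻¹ - (x₁ * (1 + x₁)⁻¹)⁻¹ = x₂⁻¹ - x₁⁻¹ := by
  field_simp
  ring

end Toy

/-! ## Algebra: augmentations of principal units, fractions -/
section Algebra

variable {E : Type u} [Field E] (B : Subring E)

/-- `(1 + e)^n − 1 ∈ e·B` for `e ∈ B` with `(1+e)⁻¹ ∈ B` and `n : ℤ` (geometric sum; for `n < 0` multiply by
`−(1+e)^n`). [folklore] -/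
theorem exists_one_add_zpow_sub_one_eq_mul {e : E} (he : e ∈ B) (hinv : (1 + e)⁻¹ ∈ B) (n : ℤ) :
    ∃ c ∈ B, (1 + e) ^ n - 1 = e * c := by
  have h1 : (1 + e) ∈ B := B.add_mem B.one_mem he
  by_cases h0 : 1 + e = 0
  · refine ⟨1 - (1 + e) ^ n, B.sub_mem B.one_mem (zpow_mem_of_inv_mem B h1 hinv n), ?_⟩
    have he1 : e = -1 := by linear_combination h0
    rw [he1]
    ring
  have hnat : ∀ m : ℕ, ∃ c ∈ B, (1 + e) ^ (m : ℤ) - 1 = e * c := fun m => by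
    refine ⟨∑ i ∈ Finset.range m, (1 + e) ^ i, B.sum_mem fun i _ => B.pow_mem h1 i, ?_⟩
    have h := geom_sum_mul (1 + e) m
    rw [add_sub_cancel_left] at h
    rw [zpow_natCast, ← h, mul_comm]
  obtain ⟨m, rfl | rfl⟩ := n.eq_nat_or_neg
  · exact hnat m
  · obtain ⟨c, hc, ec⟩ := hnat m
    have hz : (1 + e) ^ (m : ℤ) * (1 + e) ^ (-(m : ℤ)) = 1 := by
      rw [← zpow_add₀ h0, add_neg_cancel, zpow_zero]
    exact ⟨-((1 + e) ^ (-(m : ℤ)) * c), B.neg_mem (B.mul_mem (zpow_mem_of_inv_mem B h1 hinv _) hc), by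
      linear_combination (-(1 + e) ^ (-(m : ℤ))) * ec + hz⟩

/-- `(1 + e₁)^a (1 + e₂)^b − 1 ∈ e₁·B + e₂·B`. [folklore] -/
theorem exists_zpow_mul_zpow_sub_one_eq {e₁ e₂ : E} (he₁ : e₁ ∈ B) (hinv₁ : (1 + e₁)⁻¹ ∈ B) (he₂ : e₂ ∈ B)
    (hinv₂ : (1 + e₂)⁻¹ ∈ B) (a b : ℤ) :
    ∃ c₁ ∈ B, ∃ c₂ ∈ B, (1 + e₁) ^ a * (1 + e₂) ^ b - 1 = e₁ * c₁ + e₂ * c₂ := by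
  obtain ⟨c₁, hc₁, e1⟩ := exists_one_add_zpow_sub_one_eq_mul B he₁ hinv₁ a
  obtain ⟨c₂, hc₂, e2⟩ := exists_one_add_zpow_sub_one_eq_mul B he₂ hinv₂ b
  refine ⟨c₁, hc₁, (1 + e₁) ^ a * c₂,
    B.mul_mem (zpow_mem_of_inv_mem B (B.add_mem B.one_mem he₁) hinv₁ a) hc₂, ?_⟩
  linear_combination e1 + (1 + e₁) ^ a * e2

/-- `z·u^n` (`z, u ∈ T`, `n : ℤ`) is a fraction of `T`. [folklore] -/
theorem exists_mul_zpow_eq_div (T : Subring E) {z u : E} (hz : z ∈ T) (hu : u ∈ T) (n : ℤ) :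
    ∃ a b : E, a ∈ T ∧ b ∈ T ∧ z * u ^ n = a / b := by
  obtain ⟨m, rfl | rfl⟩ := n.eq_nat_or_neg
  · exact ⟨z * u ^ m, 1, T.mul_mem hz (T.pow_mem hu m), T.one_mem, by rw [zpow_natCast, div_one]⟩
  · exact ⟨z, u ^ m, hz, T.pow_mem hu m, by rw [zpow_neg, zpow_natCast, div_eq_mul_inv]⟩

end Algebra

/-! ## The kind `λ₂^{AS}`: Artin–Schreier pair frames -/
section Kind

open Summit.ResolutionOfSingularities.ResolutionOfSingularities.Theorems.TameQuotientLU

variable (k : Type) [Field k] {K : Type} [Field K] [Algebra k K]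

/-- **THE KIND (λ₂^{AS}) — ARTIN–SCHREIER PAIR FRAMES** (tag: a SUB-KIND of the door `λ₂`, not a cell ·
DECIDED: it COLLAPSES into `λ′ ∪ PR`, engine file 4, place level file 5): the kind
`λ″ = WildLogDiagonalMixedAbove` VERBATIM (Galois header `[K′:K] = p = char k`, `G`-stable prolongation `O′` with
residues in `k`, above every f.g. birational `R ⊆ O` a `G`-stable model `M = ι(R)[t₀] ⊆ O′` regular at the centre with
the frame clauses (F1)–(F5)), the unit clause and the moved clause REPLACED by the AS-PAIR CLAUSE: two DISTINCT frame
coordinates `x′_{j₁} ≠ x′_{j₂}` lying IN THE MODEL are `℘`-generators — `g x′_{j_i} = x′_{j_i}(1 + x′_{j_i})⁻¹` — and every frame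
cocycle is `(1 + x′_{j₁})^{N₁ j}(1 + x′_{j₂})^{N₂ j}` (`N₁ j₁ = −1, N₂ j₁ = 0, N₁ j₂ = 0, N₂ j₂ = −1`).  INHABITANT (model
level): the door's proved rank-2 test datum, the two-pivot top `g x_i = x_i/(1 + x_i)` (`i = 1, 2`), `g x₃ = x₃`
(`N₁ = −e₁`, `N₂ = −e₂`). [cite: KiralyLutkebohmert2013, Thm. 2] [cite: CossartPiltant2008, proof of Prop. 8.1 (HAL p. 23)] -/
def WildLogASPairAbove (O : ValuationSubring K) : Prop :=
  ∃ K' : IntermediateField K (AlgebraicClosure K), FiniteDimensional K K' ∧ IsGalois K K' ∧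
    (Module.finrank K K').Prime ∧ ((Module.finrank K K' : ℕ) : k) = 0 ∧
    ∃ O' : ValuationSubring K', O'.comap (algebraMap K K') = O ∧
      (∀ g : K' ≃ₐ[K] K', ∀ y : K', y ∈ O' ↔ g y ∈ O') ∧
      (∀ y ∈ O', ∃ c : k, y - algebraMap k K' c ∈ O'.nonunits) ∧
      ∀ R : Subalgebra k K, R.FG → IsFractionRing R K → R.toSubring ≤ O.toSubring →
        ∃ t₀ : Finset K', modelAbove k R K' t₀ ≤ O'.toSubring ∧
          (∀ g : K' ≃ₐ[K] K', ∀ y ∈ modelAbove k R K' t₀, g y ∈ modelAbove k R K' t₀) ∧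
          IsRegularLocalRing (locAtCentre (modelAbove k R K' t₀) O') ∧
          ∃ d : ℕ, ∃ x x' : Fin d → K', ∃ A : Fin d → Fin d → ℕ, ∃ g : K' ≃ₐ[K] K',
          ∃ j₁ j₂ : Fin d, ∃ N₁ N₂ : Fin d → ℤ,
            ringKrullDim (locAtCentre (modelAbove k R K' t₀) O') = d ∧
            (∀ i, x i ∈ locAtCentre (modelAbove k R K' t₀) O' ∧ O'.valuation (x i) < 1) ∧
            (∀ b ∈ locAtCentre (modelAbove k R K' t₀) O', O'.valuation b < 1 →
              ∃ c : Fin d → K', (∀ i, c i ∈ locAtCentre (modelAbove k R K' t₀) O') ∧ b = ∑ i, c i * x i) ∧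
            (∀ j, x' j ≠ 0 ∧ x' j ∈ O' ∧ O'.valuation (x' j) < 1 ∧
              ∃ a b : K', a ∈ modelAbove k R K' t₀ ∧ b ∈ modelAbove k R K' t₀ ∧ x' j = a / b) ∧
            (∀ i, x i = ∏ j, x' j ^ A i j) ∧
            (x' j₁ ≠ x' j₂ ∧ x' j₁ ∈ modelAbove k R K' t₀ ∧ x' j₂ ∈ modelAbove k R K' t₀ ∧
              N₁ j₁ = -1 ∧ N₂ j₁ = 0 ∧ N₁ j₂ = 0 ∧ N₂ j₂ = -1) ∧
            ∀ j, g (x' j) = x' j * (1 + x' j₁) ^ N₁ j * (1 + x' j₂) ^ N₂ j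

variable {k}

set_option maxHeartbeats 400000 in
/-- **`λ₂^{AS} → λ″`** (kernel inclusion): the cocycles `u_j = (1 + x′_{j₁})^{N₁ j}(1 + x′_{j₂})^{N₂ j}` are units of
`B = M_𝔪′` because `1 + x′_{j_i} ∈ M` has value `1`, and the coordinate `x′_{j₁}` is MOVED: `(1 + x′_{j₁})⁻¹ ≠ 1` as
`x′_{j₁} ≠ 0` (no characteristic argument needed). [folklore] -/
theorem wildLogDiagonalMixedAbove_of_wildLogASPairAbove {O : ValuationSubring K} (h : WildLogASPairAbove k O) :
    WildLogDiagonalMixedAbove k O := by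
  classical
  obtain ⟨K', hfd, hgal, hprime, hchar, O', hO'O, hGO', hκ', hLU⟩ := h
  refine ⟨K', hfd, hgal, hprime, hchar, O', hO'O, hGO', hκ', fun R hRfg hRfrac hRO => ?_⟩
  obtain ⟨t₀, hMO, hGM, hreg, d, x, x', A, g, j₁, j₂, N₁, N₂, hdim, hx, hgen, hx', hmon,
    ⟨hj, hj₁M, hj₂M, hN₁₁, hN₂₁, hN₁₂, hN₂₂⟩, htw⟩ := hLU R hRfg hRfrac hRO
  set M : Subring K' := modelAbove k R K' t₀ with hMdef
  have hU : ∀ {y : K'}, y ∈ M → O'.valuation y < 1 →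
      (1 + y) ∈ locAtCentre M O' ∧ (1 + y)⁻¹ ∈ locAtCentre M O' := fun {y} hyM hyv =>
    have h1 : (1 + y) ∈ locAtCentre M O' := le_locAtCentre M O' (M.add_mem M.one_mem hyM)
    ⟨h1, inv_mem_locAtCentre h1 (valuation_one_add_eq_one O' hyv)⟩
  obtain ⟨hU₁, hU₁i⟩ := hU hj₁M (hx' j₁).2.2.1
  obtain ⟨hU₂, hU₂i⟩ := hU hj₂M (hx' j₂).2.2.1
  refine ⟨t₀, hMO, hGM, hreg, d, x, x', A, g, hdim, hx, hgen, hx', hmon, fun j => ?_, j₁, fun e => ?_⟩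
  · refine ⟨(1 + x' j₁) ^ N₁ j * (1 + x' j₂) ^ N₂ j,
      Subring.mul_mem _ (zpow_mem_of_inv_mem _ hU₁ hU₁i (N₁ j)) (zpow_mem_of_inv_mem _ hU₂ hU₂i (N₂ j)), ?_,
      by rw [htw j, mul_assoc]⟩
    rw [mul_inv, ← zpow_neg, ← zpow_neg]
    exact Subring.mul_mem _ (zpow_mem_of_inv_mem _ hU₁ hU₁i (-N₁ j)) (zpow_mem_of_inv_mem _ hU₂ hU₂i (-N₂ j))
  · rw [htw j₁, hN₁₁, hN₂₁, zpow_zero, mul_one, zpow_neg, zpow_one] at e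
    have hx0 : x' j₁ ≠ 0 := (hx' j₁).1
    have h1 : (1 + x' j₁)⁻¹ = 1 := mul_left_cancel₀ hx0 (e.trans (mul_one (x' j₁)).symm)
    have h2 : (1 + x' j₁) = 1 := by rw [← inv_inv (1 + x' j₁), h1, inv_one]
    exact hx0 (by linear_combination h2)

/-- Fully-qualified audit example: the kernel inclusion, verbatim kinds. -/
example {O : ValuationSubring K}
    (h : Summit.ResolutionOfSingularities.ResolutionOfSingularities.Theorems.WildASPairLU.WildLogASPairAbove k O) :
    Summit.ResolutionOfSingularities.ResolutionOfSingularities.Theorems.WildLogDiagonalLU.WildLogDiagonalMixedAbove k O :=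
  wildLogDiagonalMixedAbove_of_wildLogASPairAbove h

end Kind

end Summit.ResolutionOfSingularities.ResolutionOfSingularities.Theorems.WildASPairLU

end
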